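/-
Copyright (c) 2026. All rights reserved.
Released under Apache 2.0 license as described in the file LICENSE.
Authors: abc-iut cell, seat abc-iut-w5-d116 (gen 6).
-/
import Mathlib.FieldTheory.KummerExtension
import Mathlib.FieldTheory.Fixed
import Mathlib.FieldTheory.Galois.Basic
import Mathlib.FieldTheory.IsAlgClosed.Basic
import Mathlib.FieldTheory.AbsoluteGaloisGroup
import Mathlib.RingTheory.Polynomial.Cyclotomic.Roots
import Mathlib.RingTheory.RootsOfUnity.AlgebraicallyClosed
import Mathlib.GroupTheory.Perm.Cycle.Type
import Literature.NumberTheory.GaloisRepresentations.AbsGaloisInvolutions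
import HarnessLib

/-!
# Artin–Schreier: a proper subfield of finite codimension in an algebraically closed field of
# characteristic `0` has codimension `2`; torsion automorphisms have order `2`

E. Artin, O. Schreier, *Eine Kennzeichnung der reell abgeschlossenen Körper*, Abh. Math. Sem. Univ.
Hamburg 5 (1927) 225–231 [ArtinSchreier1927Kennzeichnung]: if an algebraically closed field `C` is a finite
proper extension of a subfield `L`, then `[C : L] = 2` and `C = L(√-1)` (and `L` is real closed); consequently
an element of finite order `> 1` of an absolute Galois group has order `2` (S. Lang, *Algebra*, VI §9,
Cor. 9.3; J. Neukirch, A. Schmidt, K. Wingberg, *Cohomology of Number Fields*, (12.1.7), first half).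

This PROOF-ONLY file (no definitions) is the CONVERSE companion of `RealClosed/FiniteExtension.lean`
(`finrank_le_two_of_isGalois`: finite extensions of a real closed field have degree `≤ 2`) and the
finite-ORDER companion of the involution files `AbsGaloisInvolutions.lean` (abc-iut-w5-d214) /
`ArtinSchreierInvolution.lean` (abc-iut-w5-d176), whose `AbsGaloisInvolution.apply_sqrt_neg_one` («a
non-trivial involution of `C` sends `i` to `-i`») is consumed BY NAME.  Characteristic `0` throughout.

* `not_odd_prime_eq_finrank` / `not_odd_prime_dvd_finrank` — for `K ⊆ C` of finite codimension, no ODD prime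
  divides `[C : K]`: an element of odd prime order `p` of `Gal(C/K)` has a fixed field `K'` with `[C : K'] = p`;
  `μ_p ⊆ K'` (the degree of `K'(ζ_p)/K'` divides `p` and is `≤ p - 1`); Kummer theory (Mathlib
  `exists_root_adjoin_eq_top_of_isCyclic`) gives `C = K'(α)`, `α^p = a ∈ K'` not a `p`-th power; a `p`-th root
  `β` of `α` has minimal polynomial `X^{p²} - a` (Mathlib `X_pow_sub_C_irreducible_of_prime_pow`, `p` odd), of
  degree `p² > p = [C : K']` — absurd.
* `finrank_eq_two_of_one_lt_finrank` — **`1 < [C : L] < ∞ ⇒ [C : L] = 2`** and `adjoin_sqrt_neg_one_eq_top`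
  — **`C = L(√-1)`**: over `M := L(i)` the group `Gal(C/M)` has no element of odd prime order (above) and no
  involution (an involution of `C` moves `i`, `apply_sqrt_neg_one`), hence is trivial (Cauchy).
* `orderOf_eq_two_of_isOfFinOrder` — every element of finite order `> 1` of a group acting FAITHFULLY by
  ring automorphisms on an algebraically closed field of characteristic `0` has order `2` (Artin's lemma
  `FixedPoints.finrank_eq_card` + the above); `absoluteGaloisGroup_orderOf_eq_two_of_isOfFinOrder` — the
  case of `Field.absoluteGaloisGroup K`, `char K = 0`: **the torsion of `G_K` is `2`-torsion** — with
  abc-iut-w5-d214's `exists_isComplexConjugationAt_of_sq_eq_one`, for `K` algebraic over `ℚ` the torsion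
  elements of `G_K` are exactly the complex conjugations ([NSW] (12.1.7)):
  `absoluteGaloisGroup_isOfFinOrder_iff_exists_isComplexConjugation` (v2).

abc-iut cell, claim «ARTIN–SCHREIER-FINITE-INDEX» (campaign-L prerequisite of the genuine [AbsTopIII] §5
number-field context: archimedean places of `Π = G_F` from its torsion, GAP-LEDGER G-L4d2g4-1 lineage).
Classical; nothing here bears on [IUTchIII] Cor. 3.12.
-/

noncomputable section

open Polynomial Module IntermediateField
open scoped IntermediateField

namespace Literature.FieldTheory.RealClosed

universe u v

/-! ### No odd prime divides the codimension of a subfield of an algebraically closed field -/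

section OddPrime

variable (K : Type u) (C : Type v) [Field K] [Field C] [Algebra K C] [IsAlgClosed C] [CharZero K]
  [FiniteDimensional K C]

/-- A finite subextension `C/K` with `C` algebraically closed is Galois (characteristic `0`).
[cite: ArtinSchreier1927Kennzeichnung, Satz 4] -/
theorem isGalois_of_isAlgClosed : IsGalois K C :=
  haveI : IsAlgClosure K C := ⟨inferInstance, inferInstance⟩
  IsAlgClosure.isGalois K C

/-- **No subfield of odd prime codimension.**  If `C` is algebraically closed of characteristic `0` and
`[C : K] = p` is an odd prime, contradiction: `μ_p ⊆ K` by a degree count, so `C = K(α)` with `α^p = a ∈ K`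
(Kummer), `a` is not a `p`-th power in `K`, and a `p`-th root of `α` in `C` has degree `p² > p` over `K`.
[cite: ArtinSchreier1927Kennzeichnung, Satz 4] -/
theorem not_odd_prime_eq_finrank {p : ℕ} (hp : p.Prime) (hp2 : p ≠ 2) (hKC : finrank K C = p) :
    False := by
  classical
  haveI := isGalois_of_isAlgClosed K C
  haveI : Fact p.Prime := ⟨hp⟩
  haveI : CharZero C := charZero_of_injective_algebraMap (algebraMap K C).injective
  haveI : NeZero (p : C) := NeZero.charZero
  haveI : NeZero p := ⟨hp.ne_zero⟩
  -- a primitive `p`-th root of unity `ζ ∈ C` lies in `K`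
  obtain ⟨ζ, hζ⟩ := HasEnoughRootsOfUnity.exists_primitiveRoot C p
  have hζint : IsIntegral K ζ := Algebra.IsIntegral.isIntegral ζ
  have hdeg : finrank K K⟮ζ⟯ ≤ p - 1 := by
    rw [adjoin.finrank hζint]
    have hroot : aeval ζ (cyclotomic p K) = 0 := by
      rw [aeval_def, ← eval_map, map_cyclotomic, ← IsRoot.def, isRoot_cyclotomic_iff]
      exact hζ
    have hdvd := minpoly.dvd K ζ hroot
    calc (minpoly K ζ).natDegree ≤ (cyclotomic p K).natDegree :=
          natDegree_le_of_dvd hdvd (cyclotomic_ne_zero p K)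
      _ = p - 1 := by rw [natDegree_cyclotomic, Nat.totient_prime hp]
  have hdvdp : finrank K K⟮ζ⟯ ∣ p := by
    rw [← hKC, ← Module.finrank_mul_finrank K K⟮ζ⟯ C]
    exact dvd_mul_right _ _
  have hone : finrank K K⟮ζ⟯ = 1 := by
    rcases (Nat.dvd_prime hp).mp hdvdp with h | h
    · exact h
    · exfalso; have := hp.two_le; omega
  have hζbot : ζ ∈ (⊥ : IntermediateField K C) := finrank_adjoin_simple_eq_one_iff.mp hone
  obtain ⟨ζK, hζK⟩ := IntermediateField.mem_bot.mp hζbot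
  have hζKprim : IsPrimitiveRoot ζK p :=
    IsPrimitiveRoot.of_map_of_injective (f := algebraMap K C) (by rw [hζK]; exact hζ)
      (algebraMap K C).injective
  -- Kummer: `C = K(α)` with `α ^ p = a ∈ K`
  have hprim : (primitiveRoots (finrank K C) K).Nonempty :=
    ⟨ζK, by rw [hKC, mem_primitiveRoots hp.pos]; exact hζKprim⟩
  haveI : IsCyclic (C ≃ₐ[K] C) := by
    apply isCyclic_of_prime_card (p := p)
    rw [IsGalois.card_aut_eq_finrank, hKC]
  obtain ⟨α, hαp, hαtop⟩ := exists_root_adjoin_eq_top_of_isCyclic K C hprim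
  rw [hKC] at hαp
  obtain ⟨a, ha⟩ := hαp
  -- `a` is not a `p`-th power in `K`
  have hap : ∀ b : K, b ^ p ≠ a := by
    intro b hb
    -- then `α` lies in `K`, contradicting `K⟮α⟯ = ⊤ ≠ ⊥`
    have hαbot : α ∈ (⊥ : IntermediateField K C) := by
      by_cases hb0 : b = 0
      · rw [hb0, zero_pow hp.ne_zero] at hb
        have hα0 : α = 0 := by
          have : α ^ p = 0 := by rw [← ha, ← hb, map_zero]
          exact pow_eq_zero_iff hp.ne_zero |>.mp this
        rw [hα0]; exact zero_mem _
      · have hβ0 : algebraMap K C b ≠ 0 := (map_ne_zero_iff _ (algebraMap K C).injective).mpr hb0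
        have hαp0 : α ^ p ≠ 0 := by rw [← ha, ← hb, map_pow]; exact pow_ne_zero _ hβ0
        have hquot : (α / algebraMap K C b) ^ p = 1 := by
          rw [div_pow, ← map_pow, hb, ha, div_self hαp0]
        obtain ⟨j, -, hj⟩ := hζ.eq_pow_of_pow_eq_one hquot
        have hα : α = algebraMap K C (ζK ^ j * b) := by
          rw [map_mul, map_pow, hζK, hj, div_mul_cancel₀ _ hβ0]
        rw [hα]; exact IntermediateField.mem_bot.mpr ⟨_, rfl⟩
    have hbot : K⟮α⟯ = ⊥ := adjoin_simple_eq_bot_iff.mpr hαbot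
    have h1 : finrank K C = 1 := by
      rw [← IntermediateField.finrank_top', ← hαtop, hbot, IntermediateField.finrank_bot]
    rw [hKC] at h1
    exact hp.one_lt.ne' h1
  -- a `p`-th root `β` of `α` has minimal polynomial `X ^ (p ^ 2) - a`, of degree `p ^ 2 > p`
  obtain ⟨β, hβ⟩ := IsAlgClosed.exists_pow_nat_eq α hp.pos
  have hβint : IsIntegral K β := Algebra.IsIntegral.isIntegral β
  have hirr : Irreducible (X ^ (p ^ 2) - Polynomial.C a) := X_pow_sub_C_irreducible_of_prime_pow hp hp2 2 hap
  have hβroot : aeval β (X ^ (p ^ 2) - Polynomial.C a) = 0 := by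
    rw [map_sub, aeval_C, map_pow, aeval_X, pow_two, pow_mul, hβ, ha, sub_self]
  have hmin : X ^ (p ^ 2) - Polynomial.C a = minpoly K β :=
    minpoly.eq_of_irreducible_of_monic hirr hβroot (monic_X_pow_sub_C a (pow_ne_zero 2 hp.ne_zero))
  have hdegβ : finrank K K⟮β⟯ = p ^ 2 := by
    rw [adjoin.finrank hβint, ← hmin, natDegree_X_pow_sub_C]
  have hdvd2 : p ^ 2 ∣ p := by
    rw [← hdegβ, ← hKC, ← Module.finrank_mul_finrank K K⟮β⟯ C]
    exact dvd_mul_right _ _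
  have hle : p ^ 2 ≤ p := Nat.le_of_dvd hp.pos hdvd2
  have : p ≤ 1 := by nlinarith [hp.pos]
  exact absurd hp.one_lt (not_lt.mpr this)

/-- **No odd prime divides `[C : K]`** for `K ⊆ C` of finite codimension, `C` algebraically closed of
characteristic `0`: an element of odd prime order `p` of `Gal(C/K)` (Cauchy) would have a fixed field of
codimension `p`. [cite: ArtinSchreier1927Kennzeichnung, Satz 4] -/
theorem not_odd_prime_dvd_finrank {p : ℕ} (hp : p.Prime) (hp2 : p ≠ 2) : ¬ p ∣ finrank K C := by
  intro hdvd
  haveI := isGalois_of_isAlgClosed K C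
  haveI : Fact p.Prime := ⟨hp⟩
  rw [← IsGalois.card_aut_eq_finrank] at hdvd
  obtain ⟨σ, hσ⟩ := exists_prime_orderOf_dvd_card' p hdvd
  set H : Subgroup (C ≃ₐ[K] C) := Subgroup.zpowers σ with hH
  have hcard : Nat.card H = p := by rw [hH, Nat.card_zpowers, hσ]
  set K' : IntermediateField K C := fixedField H with hK'
  have hK'C : finrank K' C = p := by rw [hK', finrank_fixedField_eq_card, hcard]
  haveI : CharZero K' := charZero_of_injective_algebraMap (algebraMap K K').injective
  exact not_odd_prime_eq_finrank K' C hp hp2 hK'C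

end OddPrime

/-! ### The theorem of Artin–Schreier: finite codimension `> 1` is codimension `2` -/

section Main

variable (L : Type u) (C : Type v) [Field L] [Field C] [Algebra L C] [IsAlgClosed C] [CharZero L]
  [FiniteDimensional L C]

/-- Over `M := L(i)`, `i² = -1`, the Galois group `Gal(C/M)` is trivial: it has no element of odd prime order
(`not_odd_prime_dvd_finrank`) and no involution (a non-trivial involution of `C` sends `i` to `-i`,
`AbsGaloisInvolution.apply_sqrt_neg_one`), so `[C : L(i)] = 1`. [cite: ArtinSchreier1927Kennzeichnung, Satz 4] -/
theorem finrank_adjoin_sqrt_neg_one_eq_one {i : C} (hi : i * i = -1) : finrank L⟮i⟯ C = 1 := by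
  classical
  haveI : CharZero C := charZero_of_injective_algebraMap (algebraMap L C).injective
  set M : IntermediateField L C := L⟮i⟯ with hM
  haveI : CharZero M := charZero_of_injective_algebraMap (algebraMap L M).injective
  haveI := isGalois_of_isAlgClosed M C
  by_contra hne
  have hpos : 0 < finrank M C := finrank_pos
  obtain ⟨q, hq, hqdvd⟩ := Nat.exists_prime_and_dvd (show finrank M C ≠ 1 from hne)
  by_cases hq2 : q = 2
  · -- an involution of `C` over `M ∋ i`: impossible
    subst hq2
    haveI : Fact (Nat.Prime 2) := ⟨Nat.prime_two⟩
    rw [← IsGalois.card_aut_eq_finrank] at hqdvd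
    obtain ⟨τ, hτ⟩ := exists_prime_orderOf_dvd_card' 2 hqdvd
    have hτ1 : τ ≠ 1 := by
      intro h; rw [h, orderOf_one] at hτ; exact absurd hτ (by norm_num)
    have hττ : ∀ y : C, τ (τ y) = y := by
      intro y
      have h2 : τ * τ = 1 := by rw [← pow_two, ← hτ, pow_orderOf_eq_one]
      have := congrArg (fun f : C ≃ₐ[M] C => f y) h2
      simpa using this
    obtain ⟨x, hx⟩ : ∃ x : C, τ x ≠ x := by
      by_contra hall
      exact hτ1 (AlgEquiv.ext fun y => not_not.mp fun hy => hall ⟨y, hy⟩)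
    have hiM : τ i = i := τ.commutes (⟨i, mem_adjoin_simple_self L i⟩ : M)
    have hneg := Literature.NumberTheory.GaloisRepresentations.AbsGaloisInvolution.apply_sqrt_neg_one
      τ.toRingEquiv (fun y => hττ y) (x := x) hx hi
    have hτi : τ i = -i := hneg
    rw [hiM] at hτi
    have h2i : (2 : C) * i = 0 := by linear_combination hτi
    have hi0 : i = 0 := by simpa using h2i
    rw [hi0, mul_zero] at hi
    exact absurd hi.symm (by norm_num)
  · exact not_odd_prime_dvd_finrank M C hq hq2 hqdvd

/-- **Artin–Schreier (1927).**  If an algebraically closed field `C` of characteristic `0` is a finite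
extension of degree `> 1` of a subfield `L`, then `[C : L] = 2`. [cite: ArtinSchreier1927Kennzeichnung, Satz 4] -/
theorem finrank_eq_two_of_one_lt_finrank (h : 1 < finrank L C) : finrank L C = 2 := by
  obtain ⟨i, hi⟩ := IsAlgClosed.exists_eq_mul_self (-1 : C)
  have h1 := finrank_adjoin_sqrt_neg_one_eq_one L C hi.symm
  have htower := Module.finrank_mul_finrank L L⟮i⟯ C
  rw [h1, mul_one] at htower
  -- `[L(i) : L] ≤ 2`
  have hint : IsIntegral L i := Algebra.IsIntegral.isIntegral i
  have hle : finrank L L⟮i⟯ ≤ 2 := by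
    rw [adjoin.finrank hint]
    have hroot : aeval i (X ^ 2 + Polynomial.C 1 : L[X]) = 0 := by
      rw [map_add, map_pow, aeval_X, aeval_C, map_one, pow_two, ← hi, neg_add_cancel]
    have hne : (X ^ 2 + Polynomial.C 1 : L[X]) ≠ 0 := (monic_X_pow_add_C (1 : L) two_ne_zero).ne_zero
    calc (minpoly L i).natDegree ≤ (X ^ 2 + Polynomial.C 1 : L[X]).natDegree :=
          natDegree_le_of_dvd (minpoly.dvd L i hroot) hne
      _ = 2 := natDegree_X_pow_add_C
  omega

/-- **Artin–Schreier (1927), second clause: `C = L(√-1)`.**  Under the same hypotheses, for any `i ∈ C` with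
`i² = -1`, `L(i)` is all of `C`. [cite: ArtinSchreier1927Kennzeichnung, Satz 4] -/
theorem adjoin_sqrt_neg_one_eq_top {i : C} (hi : i * i = -1) : L⟮i⟯ = ⊤ :=
  finrank_eq_one_iff_eq_top.mp (finrank_adjoin_sqrt_neg_one_eq_one L C hi)

end Main

/-! ### Torsion automorphisms of algebraically closed fields have order `2` -/

section Torsion

variable {G : Type u} [Group G]

/-- **Every element of finite order `> 1` of a group acting faithfully by ring automorphisms on an
algebraically closed field of characteristic `0` has order `2`** (Artin's fixed-field lemma
`[Ω : Ω^⟨σ⟩] = ord σ` + `finrank_eq_two_of_one_lt_finrank`).  In particular automorphisms of finite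
order of an algebraically closed field of characteristic `0` are involutions.
[cite: ArtinSchreier1927Kennzeichnung, Satz 4 (corollary)] -/
theorem orderOf_eq_two_of_isOfFinOrder (Ω : Type v) [Field Ω] [IsAlgClosed Ω] [CharZero Ω]
    [MulSemiringAction G Ω] [FaithfulSMul G Ω] (σ : G) (hfin : IsOfFinOrder σ) (h1 : σ ≠ 1) :
    orderOf σ = 2 := by
  classical
  set H : Subgroup G := Subgroup.zpowers σ with hH
  haveI : Finite H := hfin.finite_zpowers
  letI : Fintype H := Fintype.ofFinite H
  haveI : FaithfulSMul H Ω := ⟨fun {a b} h => Subtype.ext (FaithfulSMul.eq_of_smul_eq_smul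
    (M := G) (α := Ω) fun c => by simpa only [Subgroup.smul_def] using h c)⟩
  set L := FixedPoints.subfield H Ω with hL
  have hcard : finrank L Ω = orderOf σ := by
    rw [hL, FixedPoints.finrank_eq_card, ← Nat.card_eq_fintype_card, hH, Nat.card_zpowers]
  have hpos : 0 < orderOf σ := hfin.orderOf_pos
  haveI : FiniteDimensional L Ω := Module.finite_of_finrank_pos (by rw [hcard]; exact hpos)
  haveI : CharZero L := by
    refine charZero_of_injective_algebraMap (R := ℚ) (A := L) ?_
    exact (algebraMap ℚ L).injective
  have hlt : 1 < finrank L Ω := by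
    rw [hcard]
    have hne : orderOf σ ≠ 1 := fun h => h1 (orderOf_eq_one_iff.mp h)
    omega
  rw [← hcard]
  exact finrank_eq_two_of_one_lt_finrank L Ω hlt

end Torsion

/-- **The torsion of an absolute Galois group (characteristic `0`) is `2`-torsion**: every element of finite
order `> 1` of `Field.absoluteGaloisGroup K = Gal(K̄/K)`, `char K = 0`, has order `2`.  With
abc-iut-w5-d214's `exists_isComplexConjugationAt_of_sq_eq_one`, for `K` algebraic over
`ℚ` the torsion elements of `G_K` are exactly the complex conjugations ([NSW] (12.1.7), first half).
[cite: ArtinSchreier1927Kennzeichnung, Satz 4 (corollary for Galois groups)] -/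
theorem absoluteGaloisGroup_orderOf_eq_two_of_isOfFinOrder (K : Type u) [Field K] [CharZero K]
    (τ : Field.absoluteGaloisGroup K) (hfin : IsOfFinOrder τ) (h1 : τ ≠ 1) : orderOf τ = 2 := by
  haveI : CharZero (AlgebraicClosure K) :=
    charZero_of_injective_algebraMap (algebraMap K (AlgebraicClosure K)).injective
  -- the action / faithfulness instances are the tree's transports (`AbsGaloisGroup.lean`)
  exact orderOf_eq_two_of_isOfFinOrder (AlgebraicClosure K) τ hfin h1


/-- **[NSW] (12.1.7), torsion of absolute Galois groups of fields algebraic over `ℚ`**: an element `τ` of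
`Gal(K̄/K)` (`K` algebraic over `ℚ`, e.g. a number field) is a NON-TRIVIAL TORSION element if and only if it is
a complex conjugation for some real embedding `φ : K →+* ℝ` — Artin–Schreier's finite-index theorem
(`absoluteGaloisGroup_orderOf_eq_two_of_isOfFinOrder`) combined with abc-iut-w5-d214's
`orderOf_eq_two_iff_exists_isComplexConjugation` (involutions are complex conjugations).
[cite: ArtinSchreier1927Kennzeichnung, Satz 4 (corollary for Galois groups)] -/
theorem absoluteGaloisGroup_isOfFinOrder_iff_exists_isComplexConjugation (K : Type u) [Field K]
    [CharZero K] [Algebra.IsAlgebraic ℚ K] (τ : Field.absoluteGaloisGroup K) :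
    (IsOfFinOrder τ ∧ τ ≠ 1) ↔
      ∃ φ : K →+* ℝ, Literature.NumberTheory.GaloisRepresentations.IsComplexConjugation φ τ := by
  rw [← Literature.NumberTheory.GaloisRepresentations.orderOf_eq_two_iff_exists_isComplexConjugation]
  constructor
  · rintro ⟨hfin, h1⟩
    exact absoluteGaloisGroup_orderOf_eq_two_of_isOfFinOrder K τ hfin h1
  · intro h2
    refine ⟨isOfFinOrder_iff_pow_eq_one.mpr ⟨2, two_pos, by rw [← h2, pow_orderOf_eq_one]⟩, ?_⟩
    intro h
    rw [h, orderOf_one] at h2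
    exact absurd h2 (by norm_num)

end Literature.FieldTheory.RealClosed

end
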